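import Summits.Ventures.PercRepro.S1CellConsumersT

/-!
# PercRepro — THE MIXED KILL ON THE COLOOP LADDER (p2, gen 26; SUBCLAIM-S1 §6.10)

The coloop cases of a cell go through the exact ladder (`ladder_exact`: `c` coloops, the coloop-free part `N`, the
credits `A = Σ 2^{n−1−j}`, `B = Σ w3plus (n−1−j)`) and then a kernel line on `N`; the landed ladder consumers price
that line with the chain kill only — at `(9, 6)` the one-coloop core fails its `t = 0` line by `−421` for lack of the
four-circuit kill that closes it on the coloop-free consumer. This consumer prices the ladder line with the MIXED
kill (`mk t` triangles and `m₄ t` four-circuits of `N`), the per-`t` caps, and a supplied triangle bound.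

* **`rls_of_ladder_case_kill_mixed_capT`** — one ladder case by the mixed kill with per-`t` caps.
Axioms: standard.
-/

open scoped Matroid

namespace PercRepro

namespace S1

open Set

variable {α : Type}

/-- **ONE LADDER CASE BY THE MIXED KILL WITH PER-`t` CAPS**: `c` coloops, the coloop-free part `N` on `p + d` points of
nullity `d` with `s₃ N ≤ P` (`hPcap`), `s₄ N ≤ S t` at triangle count `t` (`hScap`); at every `t ≤ P` the two kernel
lines with the ladder credits: `s₄ < m₄ t` (the cap `m₄ t − 1`, the kill of `mk t` triangles) and `s₄ ≥ m₄ t` (the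
cap `S t`, the kill of `mk t` triangles and `m₄ t` four-circuits). -/
theorem rls_of_ladder_case_kill_mixed_capT (M : Matroid α) [M.Finite] {p0 p c d n : ℕ} (hp0 : p0 = p + c)
    (hnd : n = p0 + d) (hR : M.eRank = (p0 : ℕ∞)) (hn : M.E.ncard = n)
    (hfree : ∀ e ∈ M.E, ∃ A ⊆ M.E \ {e}, e ∉ M.closure A ∧ e ∉ M.closure ((M.E \ {e}) \ A))
    (hc : M.coloops.ncard = c) (hp : 6 ≤ p) (hd4 : 4 ≤ d) {P S5 : ℕ} (S : ℕ → ℕ)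
    (hPcap : ∀ (N : Matroid α) [N.Finite],
      (∀ e ∈ N.E, ∃ A ⊆ N.E \ {e}, e ∉ N.closure A ∧ e ∉ N.closure ((N.E \ {e}) \ A)) →
      N.E.encard = N.eRank + ((d : ℕ) : ℕ∞) → N.E.ncard = p + d → N.coloops = ∅ →
      {C : Set α | N.IsCircuit C ∧ C.ncard = 3}.ncard ≤ P)
    (hScap : ∀ (N : Matroid α) [N.Finite],
      (∀ e ∈ N.E, ∃ A ⊆ N.E \ {e}, e ∉ N.closure A ∧ e ∉ N.closure ((N.E \ {e}) \ A)) →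
      N.E.encard = N.eRank + ((d : ℕ) : ℕ∞) → N.E.ncard = p + d → N.coloops = ∅ →
      ∀ t, {C : Set α | N.IsCircuit C ∧ C.ncard = 3}.ncard = t →
      {C : Set α | N.IsCircuit C ∧ C.ncard = 4}.ncard ≤ S t)
    (hS5 : (p + d) * avgChain5b (d - 1) / (p + d - 5) ≤ S5)
    (mk m₄ : ℕ → ℕ) (hmk : ∀ t ∈ Finset.range (P + 1), mk t ≤ t)
    (hsmall : ∀ t ∈ Finset.range (P + 1), ladderOK p0 p d t (m₄ t - 1) S5
      ((∑ j ∈ Finset.range c, 2 ^ (n - 1 - j)) + mk t * (p + d - 3).choose (p - 3))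
      ((∑ j ∈ Finset.range c, w3plus (n - 1 - j)) + (mk t).choose 2 * (p + d - 5).choose (p - 5)) = true)
    (hbig : ∀ t ∈ Finset.range (P + 1), ladderOK p0 p d t (S t) S5
      ((∑ j ∈ Finset.range c, 2 ^ (n - 1 - j)) +
        (mk t * (p + d - 3).choose (p - 3) + m₄ t * (p + d - 4).choose (p - 4)))
      ((∑ j ∈ Finset.range c, w3plus (n - 1 - j)) + (mk t + m₄ t).choose 2 * (p + d - 5).choose (p - 5)) = true) :
    ThmN.RLS M p0 4 := by
  subst hp0
  have hR' : M.eRank = ((p + c : ℕ) : ℕ∞) := hR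
  obtain ⟨N, hNfin, hNR, hNn, hNcol, hNfree, hNtop, hNmid⟩ := ladder_exact c M p hR' (by omega) (by omega) hfree
  have hNn' : N.E.ncard = p + d := by omega
  have hNcol0 : N.coloops = ∅ := by
    have h0 : N.coloops.ncard = 0 := by omega
    exact (Set.ncard_eq_zero (N.ground_finite.subset N.coloops_subset_ground)).1 h0
  have hNd : N.E.encard = N.eRank + ((d - 1 + 1 : ℕ) : ℕ∞) := by
    rw [hNR, ← N.ground_finite.cast_ncard_eq, hNn', show d - 1 + 1 = d by omega]
    push_cast
    ring
  have hNd' : N.E.encard = N.eRank + (((d - 1 : ℕ) : ℕ∞) + 1) := by rw [hNd, Nat.cast_succ]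
  have hNdd : N.E.encard = N.eRank + ((d : ℕ) : ℕ∞) := by rw [hNd, show d - 1 + 1 = d by omega]
  have hP' : {C : Set α | N.IsCircuit C ∧ C.ncard = 3}.ncard ≤ P := hPcap N hNfree hNdd hNn' hNcol0
  have hS' := hScap N hNfree hNdd hNn' hNcol0 _ rfl
  have hS5' := (ncard_fiveCircuits_le_of_coloopFree N hNfree hNd' hNcol0 hNn' (by omega)).trans hS5
  have hC1 : ∀ L ⊆ N.E, N.eRk L = 2 → L.ncard ≤ 3 := by
    intro L hL hr
    have := ThmN.ncard_add_one_le_two_pow_of_eRk_le N (ThmN.not_isLoop_of_free N hNfree) hNfree 2 L hL hr.le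
    omega
  classical
  set t := {C : Set α | N.IsCircuit C ∧ C.ncard = 3}.ncard with ht
  set u := {C : Set α | N.IsCircuit C ∧ C.ncard = 4}.ncard with hu
  set A := ∑ j ∈ Finset.range c, 2 ^ (n - 1 - j) with hA
  set B := ∑ j ∈ Finset.range c, w3plus (n - 1 - j) with hB
  have htI : t ∈ Finset.range (P + 1) := Finset.mem_range.2 (by omega)
  -- the triangles of the kill
  have h𝒯₃ : ∃ 𝒯₃ : Finset (Set α), 𝒯₃.card = mk t ∧ ∀ C ∈ 𝒯₃, N.IsCircuit C ∧ C.ncard = 3 := by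
    rcases Nat.eq_zero_or_pos (mk t) with h0 | hpos
    · exact ⟨∅, by rw [h0, Finset.card_empty], fun C hC => absurd hC (Finset.notMem_empty C)⟩
    · obtain ⟨𝒯, h1, h2⟩ := exists_finset_of_le_ncard hpos ((hmk t htI).trans (le_of_eq ht))
      exact ⟨𝒯, h1, h2⟩
  obtain ⟨𝒯₃, h𝒯₃card, h𝒯₃mem⟩ := h𝒯₃
  have hpair₃ : ∀ C ∈ 𝒯₃, ∀ C' ∈ 𝒯₃, C ≠ C' → 5 ≤ (C ∪ C').ncard := fun C hC C' hC' hne =>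
    five_le_ncard_union_of_triangles N hC1 (h𝒯₃mem C hC) (h𝒯₃mem C' hC') hne
  -- the weighted inequality on `N`
  have hw : phiK (p + c) 4 * (Matroid.topCount N p 4 : ℚ) + B ≤ (Matroid.midCount N p 4 : ℚ) + A := by
    rcases Nat.lt_or_ge u (m₄ t) with hsmallu | hbigu
    · exact weighted_of_ladderOK_kill N (p + c) p d t (m₄ t - 1) S5 A B hd4 hNR hNn' hNfree le_rfl (by omega) hS5'
        (by omega) (by omega) 3 (by omega) 𝒯₃ h𝒯₃mem hpair₃ (by rw [h𝒯₃card]; exact hsmall t htI)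
    · have h𝒯₄ : ∃ 𝒯₄ : Finset (Set α), 𝒯₄.card = m₄ t ∧ ∀ C ∈ 𝒯₄, N.IsCircuit C ∧ C.ncard = 4 := by
        rcases Nat.eq_zero_or_pos (m₄ t) with h0 | hpos
        · exact ⟨∅, by rw [h0, Finset.card_empty], fun C hC => absurd hC (Finset.notMem_empty C)⟩
        · obtain ⟨𝒯, h1, h2⟩ := exists_finset_of_le_ncard hpos (hbigu.trans (le_of_eq hu))
          exact ⟨𝒯, h1, h2⟩
      obtain ⟨𝒯₄, h𝒯₄card, h𝒯₄mem⟩ := h𝒯₄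
      have hpair : ∀ C ∈ 𝒯₃ ∪ 𝒯₄, ∀ C' ∈ 𝒯₃ ∪ 𝒯₄, C ≠ C' → 5 ≤ (C ∪ C').ncard := by
        intro C hC C' hC' hne
        rw [Finset.mem_union] at hC hC'
        rcases hC with h3 | h4 <;> rcases hC' with h3' | h4'
        · exact hpair₃ C h3 C' h3' hne
        · exact five_le_ncard_union_of_triangle_four_circuit N (h𝒯₃mem C h3) (h𝒯₄mem C' h4')
        · rw [Set.union_comm]
          exact five_le_ncard_union_of_triangle_four_circuit N (h𝒯₃mem C' h3') (h𝒯₄mem C h4)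
        · exact five_le_ncard_union_of_four_circuits N (h𝒯₄mem C h4) (h𝒯₄mem C' h4') hne
      exact weighted_of_ladderOK_kill_mixed N (p + c) p d t (S t) S5 A B hd4 hNR hNn' hNfree le_rfl hS' hS5' (by omega)
        (by omega) 𝒯₃ 𝒯₄ h𝒯₃mem h𝒯₄mem hpair (by rw [h𝒯₃card, h𝒯₄card]; exact hbig t htI)
  rw [ThmN.RLS_iff, hNtop]
  rw [hn] at hNmid
  have hmidQ : ((Matroid.midCount N p 4 : ℕ) : ℚ) + ((∑ j ∈ Finset.range c, 2 ^ (n - 1 - j) : ℕ) : ℚ) ≤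
      ((Matroid.midCount M (p + c) 4 : ℕ) : ℚ) + ((∑ j ∈ Finset.range c, w3plus (n - 1 - j) : ℕ) : ℚ) := by
    exact_mod_cast hNmid
  linarith

end S1

end PercRepro
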